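import Literature.Analysis.OperatorTheory.Enflo2023.StepRealisationFar
import HarnessLib

/-!
# Enflo (2023), v2 (11) p.4 and the window remark of p.5: the Main Construction's limit over `x₀` EXISTS iff
`T` has a non-trivial closed invariant subspace AT DISTANCE `∈ [0.3, 0.7]` FROM `x₀` (`Eq11Window`)

Source: P. H. Enflo, *On the invariant subspace problem in Hilbert spaces*, arXiv:2305.15442v2 — a CLAIMED result
under adjudication (b2b-enflo repair cell; formaliser 1: Part A, pp.1–13).  This file records what FOLLOWS from the
text; it does not endorse the main theorem and concludes the invariant subspace problem for no operator.  BLOCK-2b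
value: one sentence of the text made precise, not summit progress.

THE TEXT.  v2 p.4, (11) (tex L152–L158): along the Main Construction "`(εθ)_n → 0` and with `ℓ'_n(T)y'_n` converging in norm.  Then,
for the limit `ℓ'_∞(T)y'_∞` we will have `⟨Tʲℓ'_∞(T)y'_∞, x₀ − ℓ'_∞(T)y'_∞⟩ = 0` for all `j ≥ 0`, i.e. `ℓ'_∞(T)y'_∞`
is non-cyclic", the radii being kept in `0.7 > ε = ‖x₀ − ℓ'(T)y'_n‖ > 0.3` for the whole sequence (same paragraph,
tex L152; again p.17, tex L575).  v2 p.5, tex L160–L162,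
about weighted shifts with square-summable weights and `x₀ = e₀`: "So, there is no non-trivial, closed, invariant
subspace which, as in (11), has a distance between `0.3` and `0.7` to `e₀` … we may produce many '`(εθ)_n`-almost
cyclic vectors' but we will not get norm convergence to a non-cyclic vector."

WHAT THIS FILE DECIDES.  Formaliser 2's located endgame predicate `HasMCLimit T x₀` (`StepRealisationFar` §A: a vector
`w ≠ 0` with `0.3 ≤ ‖x₀ − w‖ ≤ 0.7` whose orbit is orthogonal to `x₀ − w` — exactly the (11)-output of a
norm-convergent Main Construction over `x₀`, `hasMCLimit_of_norm_convergent_MC`) is EQUIVALENT, for a unit vector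
`x₀` of a Hilbert space, to the notion of p.5 made a definition here:

* §A `HasInvariantSubspaceInWindow T x₀` — a closed subspace `M`, `0 ≠ M ≠ H`, `TM ⊆ M`, with
  `0.3 ≤ dist(x₀, M) ≤ 0.7`.
* §B `hasMCLimit_iff_window`: `HasMCLimit T x₀ ↔ HasInvariantSubspaceInWindow T x₀` (`‖x₀‖ = 1`).  (⇒) `M` = the
  orbit closure of `w`; since `w ∈ M` and `x₀ − w ⊥ M`, the orthogonal projection of `x₀` on `M` IS `w`, so
  `dist(x₀, M) = ‖x₀ − w‖`.  (⇐) `w` = the projection of `x₀` on `M`; `Tʲw ∈ M ⊥ x₀ − w`; `w ≠ 0` because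
  `dist(x₀, M) ≤ 0.7 < 1 = ‖x₀‖`.  So the sentence of p.5 is the exact criterion — for EVERY operator and EVERY unit
  `x₀` — for the (11)-limit over `x₀` to exist at all: a Main Construction over `x₀` can converge as described on p.4
  only towards the projection of `x₀` on an invariant subspace lying in the window around `x₀`, and the located
  limit exists precisely when `Lat T` meets that window.
* §C, the manuscript's start `x₀ = (√3/2)u₀ + ½u₁` (p.7, `Lemma1.xStart`): if SOME invariant subspace contains `u₀`
  and is orthogonal to `u₁` — in particular if `u₀` is an eigenvector and `u₁ ⊥ u₀`
  (`hasMCLimit_xStart_of_eigenvector`) — the (11)-output EXISTS, with `w = y₀' = (√3/2)u₀` (`Lemma1.yStart`) at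
  distance `½`.  Instance: formaliser 2's type-1 model `T_{w₀,τ}` on `ℂ³` (`StepRealisation.Far.hasMCLimit_xStart`),
  in which the full-tree residual FAILS from far starts (`Far.not_indepRunD_of_far`, `|x₀,₀|, |x₀,₁| > 0.7` — not of
  the p.7 form relative to the model's type vector `u₀`, for which `|x₀,₁| ≤ ½`): at every start of the p.7 form the
  endgame's CONCLUSION holds there.  So calibration models whose type vector is an eigenvector (the diagonal models
  `T_τ`, `T_w` of `StepRealisationDiag*`; `T_{w₀,τ}`, `Far.TF_u_zero`) can refute the MECHANISM (the residual
  `IndepRunD` and what it drives) but never the existence of the limit at a p.7 start; by §B a refutation of the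
  (11)-output at such a start needs an operator none of whose non-trivial closed invariant subspaces lies in the
  window around `(√3/2)u₀ + ½u₁`.
* §D, the p.5 sentence typed (`not_window_of_lat_dichotomy`, `not_hasMCLimit_of_lat_dichotomy`): if every
  non-trivial closed invariant subspace of `T` either contains the unit vector `x₀` or is orthogonal to it, the
  distances are `0` or `1`, so there is no window subspace and no (11)-limit over `x₀`.  For the unilateral weighted
  shift `W` with non-zero weights of monotonically decreasing modulus in `ℓ²` and `x₀ = e₀` this hypothesis is
  Nikol'skiĭ's theorem `Lat W = {span{e_n : n ≥ k}⁻ : k ≥ 0}` (Radjavi–Rosenthal, *Invariant Subspaces* (1973)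
  Thm 4.12; Shields (1974) §10), NOT formalised here — claim table row A55 records that the printed hypothesis
  "`Σ|w_n|² < ∞`" alone does not give it; the theorem below is stated over the lattice hypothesis, which is where the
  text's "well-known" enters.

NOT HERE: which operators of the standing form admit a window subspace at the p.7 start (the Part-B question behind
`StepRealisation.IndepRunD`, formaliser 2); Nikol'skiĭ's classification; anything concluding `Referee.ISP_separable`.

Origin: planner-b2b-enflo-1-g29-0 (formaliser 1, gen 29), 2026-08-19.
-/

noncomputable section

open scoped InnerProductSpace

namespace Literature.Analysis.OperatorTheory.Enflo2023

variable {H : Type*} [NormedAddCommGroup H] [InnerProductSpace ℂ H]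

/-! ### A. The p.5 notion: an invariant subspace in the window around `x₀` -/

/-- **v2 p.5, tex L160**: "a non-trivial, closed, invariant subspace which, as in (11), has a distance between
`0.3` and `0.7` to `x₀`" — a closed subspace `M`, `M ≠ 0`, `M ≠ H`, `TM ⊆ M`, with `0.3 ≤ dist(x₀, M) ≤ 0.7`.
[cite: Enflo2023, v2 p.5 tex L160; (11) p.4] -/
def HasInvariantSubspaceInWindow (T : H →L[ℂ] H) (x₀ : H) : Prop :=
  ∃ M : Submodule ℂ H, IsClosed (M : Set H) ∧ M ≠ ⊥ ∧ M ≠ ⊤ ∧ IsInvariant T M ∧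
    (0.3 : ℝ) ≤ Metric.infDist x₀ M ∧ Metric.infDist x₀ M ≤ 0.7

/-- A window subspace is in particular a non-trivial closed invariant subspace. [folklore] -/
theorem HasInvariantSubspaceInWindow.hasNontrivialClosedInvariantSubspace {T : H →L[ℂ] H} {x₀ : H}
    (h : HasInvariantSubspaceInWindow T x₀) : HasNontrivialClosedInvariantSubspace T := by
  obtain ⟨M, hc, hb, ht, hi, -, -⟩ := h
  exact ⟨M, hc, hb, ht, hi⟩

/-- An invariant subspace is invariant under every power of `T`. [folklore] -/
lemma IsInvariant.pow_apply_mem {T : H →L[ℂ] H} {M : Submodule ℂ H} (hM : IsInvariant T M) (j : ℕ) {x : H}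
    (hx : x ∈ M) : (T ^ j) x ∈ M := by
  induction j with
  | zero => simpa using hx
  | succ j ih => rw [pow_succ', mul_apply_eq_comp]; exact hM _ ih

/-- If the orbit of `w` is orthogonal to `x₀ − w`, then `x₀ − w` is orthogonal to the whole orbit closure of `w`
(linearity and continuity of the inner product). [folklore] -/
lemma sub_mem_orthogonal_orbitClosure (T : H →L[ℂ] H) {x₀ w : H}
    (horth : ∀ j : ℕ, ⟪x₀ - w, (T ^ j) w⟫_ℂ = 0) : x₀ - w ∈ (orbitClosure T w)ᗮ := by
  have hle : orbitClosure T w ≤ (ℂ ∙ (x₀ - w))ᗮ := by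
    unfold orbitClosure
    refine Submodule.topologicalClosure_minimal _ ?_ (Submodule.isClosed_orthogonal _)
    rw [Submodule.span_le, Set.range_subset_iff]
    intro j
    exact Submodule.mem_orthogonal_singleton_iff_inner_right.2 (horth j)
  rw [Submodule.mem_orthogonal']
  intro u hu
  exact Submodule.mem_orthogonal_singleton_iff_inner_right.1 (hle hu)

/-- For a subspace `M` with orthogonal projection `P_M` (e.g. a closed subspace of a Hilbert space),
`dist(x₀, M)` is attained at the projection: `dist(x₀, M) = ‖x₀ − P_M x₀‖`. [folklore] -/
lemma infDist_eq_norm_sub_starProjection (M : Submodule ℂ H) [M.HasOrthogonalProjection] (x₀ : H) :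
    Metric.infDist x₀ M = ‖x₀ - M.starProjection x₀‖ := by
  refine le_antisymm ?_ ?_
  · rw [← dist_eq_norm]
    exact Metric.infDist_le_dist_of_mem (SetLike.mem_coe.2 (M.starProjection_apply_mem x₀))
  · rw [Submodule.starProjection_minimal, Metric.infDist_eq_iInf]
    haveI : Nonempty (M : Set H) := ⟨⟨0, SetLike.mem_coe.2 M.zero_mem⟩⟩
    refine le_ciInf fun y => ?_
    rw [dist_eq_norm]
    refine ciInf_le ⟨0, ?_⟩ (⟨(y : H), SetLike.mem_coe.1 y.2⟩ : M)
    rintro _ ⟨z, rfl⟩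
    exact norm_nonneg _

/-! ### B. (11) ⟺ a window subspace -/

/-- **(11) ⟹ the window subspace.**  If `w ≠ 0`, `0.3 ≤ ‖x₀ − w‖ ≤ 0.7` and the orbit of `w` is orthogonal to
`x₀ − w` (the (11)-output), then `M = span{Tʲw}⁻` is a non-trivial closed invariant subspace with `P_M x₀ = w`, hence
`dist(x₀, M) = ‖x₀ − w‖ ∈ [0.3, 0.7]`. [cite: Enflo2023, v2 (11) p.4; p.5 tex L160] -/
theorem HasMCLimit.hasInvariantSubspaceInWindow [CompleteSpace H] {T : H →L[ℂ] H} {x₀ : H}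
    (h : HasMCLimit T x₀) : HasInvariantSubspaceInWindow T x₀ := by
  obtain ⟨w, hw0, hlo, hhi, horth⟩ := h
  have hperp : x₀ - w ∈ (orbitClosure T w)ᗮ := sub_mem_orthogonal_orbitClosure T horth
  haveI : CompleteSpace (orbitClosure T w) := (isClosed_orbitClosure T w).completeSpace_coe
  have hproj : (orbitClosure T w).starProjection x₀ = w :=
    Submodule.eq_starProjection_of_mem_orthogonal (self_mem_orbitClosure T w) hperp
  have hdist : Metric.infDist x₀ (orbitClosure T w) = ‖x₀ - w‖ := by
    rw [infDist_eq_norm_sub_starProjection (orbitClosure T w) x₀, hproj]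
  refine ⟨orbitClosure T w, isClosed_orbitClosure T w, ?_, ?_, isInvariant_orbitClosure T w, ?_, ?_⟩
  · intro hbot
    have hw := self_mem_orbitClosure T w
    rw [hbot, Submodule.mem_bot] at hw
    exact hw0 hw
  · intro htop
    rw [htop, Submodule.top_orthogonal_eq_bot, Submodule.mem_bot] at hperp
    exact sub_ne_zero_of_window hlo hperp
  · rw [hdist]; exact hlo
  · rw [hdist]; exact hhi

/-- **The window subspace ⟹ (11).**  If `M` is a closed invariant subspace with `0.3 ≤ dist(x₀, M) ≤ 0.7` and
`‖x₀‖ = 1`, then `w = P_M x₀` is non-zero (`‖x₀ − w‖ ≤ 0.7 < 1`), lies in the window, and its orbit stays in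
`M ⊥ x₀ − w`. [cite: Enflo2023, v2 (11) p.4; p.5 tex L160] -/
theorem HasInvariantSubspaceInWindow.hasMCLimit [CompleteSpace H] {T : H →L[ℂ] H} {x₀ : H} (hx₀ : ‖x₀‖ = 1)
    (h : HasInvariantSubspaceInWindow T x₀) : HasMCLimit T x₀ := by
  obtain ⟨M, hMc, -, -, hMi, hlo, hhi⟩ := h
  haveI : CompleteSpace M := hMc.completeSpace_coe
  rw [infDist_eq_norm_sub_starProjection M x₀] at hlo hhi
  refine ⟨M.starProjection x₀, ?_, hlo, hhi, fun j => ?_⟩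
  · intro hw
    rw [hw, sub_zero, hx₀] at hhi
    norm_num at hhi
  · exact Submodule.inner_left_of_mem_orthogonal (hMi.pow_apply_mem j (M.starProjection_apply_mem x₀))
      (M.sub_starProjection_mem_orthogonal x₀)

/-- **v2 (11) p.4 ⟺ v2 p.5 — the exact criterion.**  For a unit vector `x₀` of a Hilbert space: a vector `w ≠ 0`
with `0.3 ≤ ‖x₀ − w‖ ≤ 0.7` and `x₀ − w ⊥ Tʲw` for all `j` (the limit the Main Construction is to produce over `x₀`)
EXISTS if and only if `T` has a non-trivial closed invariant subspace at distance `∈ [0.3, 0.7]` from `x₀` (and then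
`w` is the orthogonal projection of `x₀` on it). [cite: Enflo2023, v2 (11) p.4; p.5 tex L160–L162] -/
theorem hasMCLimit_iff_window [CompleteSpace H] (T : H →L[ℂ] H) {x₀ : H} (hx₀ : ‖x₀‖ = 1) :
    HasMCLimit T x₀ ↔ HasInvariantSubspaceInWindow T x₀ :=
  ⟨HasMCLimit.hasInvariantSubspaceInWindow, HasInvariantSubspaceInWindow.hasMCLimit hx₀⟩

/-- In the situation of the refused goal — no non-trivial closed invariant subspace at all — there is no (11)-limit
over ANY `x₀` (contrapositive of `HasMCLimit.hasNontrivialClosedInvariantSubspace`): the convergence asserted on p.4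
is itself an invariant-subspace statement about `T` near `x₀`. [cite: Enflo2023, v2 (11) p.4] -/
theorem not_hasMCLimit_of_not_nis {T : H →L[ℂ] H} (hT : ¬ HasNontrivialClosedInvariantSubspace T) (x₀ : H) :
    ¬ HasMCLimit T x₀ :=
  fun h => hT h.hasNontrivialClosedInvariantSubspace

/-! ### C. The manuscript's start `x₀ = (√3/2)u₀ + ½u₁` (p.7): separated data give the (11)-output for free -/

/-- If an invariant subspace `M` contains `a ≠ 0` and `b ⊥ M` with `0.3 ≤ ‖b‖ ≤ 0.7`, then over `x₀ = a + b` the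
(11)-output exists: `w = a` (no closedness or completeness needed). [cite: Enflo2023, v2 (11) p.4] -/
theorem hasMCLimit_of_mem_invariant_add_orthogonal {T : H →L[ℂ] H} {M : Submodule ℂ H} (hM : IsInvariant T M)
    {a b : H} (ha : a ∈ M) (ha0 : a ≠ 0) (hb : b ∈ Mᗮ) (hlo : (0.3 : ℝ) ≤ ‖b‖) (hhi : ‖b‖ ≤ 0.7) :
    HasMCLimit T (a + b) := by
  refine ⟨a, ha0, by simpa using hlo, by simpa using hhi, fun j => ?_⟩
  rw [add_sub_cancel_left]
  exact Submodule.inner_left_of_mem_orthogonal (hM.pow_apply_mem j ha) hb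

/-- **At the p.7 start, separated `u₀, u₁` give the limit.**  If a `T`-invariant subspace `M` contains the unit
vector `u₀` and the unit vector `u₁` is orthogonal to `M`, then over `x₀ = (√3/2)u₀ + ½u₁` the (11)-output exists:
`w = y₀' = (√3/2)u₀`, `‖x₀ − w‖ = ½`. [cite: Enflo2023, v2 p.7 (choice of x₀, y₀'); (11) p.4] -/
theorem hasMCLimit_xStart_of_separated [CompleteSpace H] {T : H →L[ℂ] H} {M : Submodule ℂ H}
    (hM : IsInvariant T M) {u₀ u₁ : H} (hu₀ : ‖u₀‖ = 1) (hu₁ : ‖u₁‖ = 1) (h₀ : u₀ ∈ M) (h₁ : u₁ ∈ Mᗮ) :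
    HasMCLimit T (Lemma1.xStart u₀ u₁) := by
  have hy : Lemma1.yStart u₀ ∈ M := by unfold Lemma1.yStart; exact M.smul_mem _ h₀
  refine ⟨Lemma1.yStart u₀, ?_, ?_, ?_, fun j => ?_⟩
  · intro h0
    have h := Lemma1.norm_yStart u₀ hu₀
    rw [h0, norm_zero] at h
    have h3 : (0 : ℝ) < Real.sqrt 3 / 2 := by positivity
    linarith
  · rw [Lemma1.norm_xStart_sub_yStart u₀ u₁ hu₁]; norm_num
  · rw [Lemma1.norm_xStart_sub_yStart u₀ u₁ hu₁]; norm_num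
  · rw [Lemma1.xStart_sub_yStart]
    exact Submodule.inner_left_of_mem_orthogonal (hM.pow_apply_mem j hy) (Mᗮ.smul_mem _ h₁)

/-- **Eigenvector `u₀`.**  If `Tu₀ = μu₀` and `u₁ ⊥ u₀` (unit vectors), then over the p.7 start
`x₀ = (√3/2)u₀ + ½u₁` the (11)-output exists, with `M = ℂu₀`.  This is the situation of every calibration model of
the record whose type vector is an eigenvector (the diagonal models of `StepRealisationDiag*`; `T_{w₀,τ}` of
`StepRealisationFar`, see `StepRealisation.Far.hasMCLimit_xStart`): there the endgame's CONCLUSION holds at every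
start of the p.7 form, whatever happens to its mechanism.
[cite: Enflo2023, v2 p.7 (choice of x₀); (11) p.4] -/
theorem hasMCLimit_xStart_of_eigenvector [CompleteSpace H] {T : H →L[ℂ] H} {u₀ u₁ : H} {μ : ℂ}
    (hT : T u₀ = μ • u₀) (hu₀ : ‖u₀‖ = 1) (hu₁ : ‖u₁‖ = 1) (h01 : ⟪u₀, u₁⟫_ℂ = 0) :
    HasMCLimit T (Lemma1.xStart u₀ u₁) := by
  have hM : IsInvariant T (ℂ ∙ u₀) := by
    intro x hx
    rw [Submodule.mem_span_singleton] at hx ⊢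
    obtain ⟨c, rfl⟩ := hx
    exact ⟨c * μ, by rw [map_smul, hT, smul_smul]⟩
  exact hasMCLimit_xStart_of_separated hM hu₀ hu₁ (Submodule.mem_span_singleton_self u₀)
    (Submodule.mem_orthogonal_singleton_iff_inner_right.2 h01)

/-- With `u₀` an eigenvector and `u₁ ⊥ u₀`, the p.7 start also carries the window subspace itself (§B).
[cite: Enflo2023, v2 p.5 tex L160; p.7 (choice of x₀)] -/
theorem hasInvariantSubspaceInWindow_xStart_of_eigenvector [CompleteSpace H] {T : H →L[ℂ] H} {u₀ u₁ : H}
    {μ : ℂ} (hT : T u₀ = μ • u₀) (hu₀ : ‖u₀‖ = 1) (hu₁ : ‖u₁‖ = 1) (h01 : ⟪u₀, u₁⟫_ℂ = 0) :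
    HasInvariantSubspaceInWindow T (Lemma1.xStart u₀ u₁) :=
  (hasMCLimit_xStart_of_eigenvector hT hu₀ hu₁ h01).hasInvariantSubspaceInWindow

/-- **Instance: formaliser 2's type-1 model `T_{w₀,τ}` on `ℂ³`** (`StepRealisationFar` §B: `u₀ ↦ w₀u₀`,
`u₁ ↦ τu₂ ↦ 0`), in which the full-tree residual `IndepRunD` fails from every far start
(`Far.not_indepRunD_of_far`).  At every start of the p.7 form `(√3/2)u₀ + ½u₁`, `u₁ ⊥ u₀` a unit vector, the
(11)-output EXISTS in that model (`u₀` is an eigenvector, `Far.TF_u_zero`): the model refutes the mechanism at far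
starts, not the existence of the limit at the text's starts. [cite: Enflo2023, v2 p.7 (choice of x₀); (11) p.4] -/
theorem StepRealisation.Far.hasMCLimit_xStart (w₀ τ : ℝ) {u₁ : StepRealisation.Far.C3} (hu₁ : ‖u₁‖ = 1)
    (h01 : ⟪(DiagN.u (0 : Fin 3) : StepRealisation.Far.C3), u₁⟫_ℂ = 0) :
    HasMCLimit (StepRealisation.Far.TF w₀ τ) (Lemma1.xStart (DiagN.u (0 : Fin 3)) u₁) :=
  hasMCLimit_xStart_of_eigenvector StepRealisation.Far.TF_u_zero (DiagN.norm_u (0 : Fin 3)) hu₁ h01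

/-! ### D. The p.5 sentence: a lattice that avoids the window gives no (11)-limit -/

/-- **v2 p.5, tex L160–L162, typed.**  If every non-trivial closed invariant subspace of `T` either CONTAINS the
unit vector `x₀` or is ORTHOGONAL to it, then none lies in the window: the distances are `0` or `1`.  For the
unilateral weighted shift with non-zero weights of monotonically decreasing modulus in `ℓ²` and `x₀ = e₀` the
hypothesis is Nikol'skiĭ's description `Lat = {span{e_n : n ≥ k}⁻}` (`e₀ ∈ M₀`, `e₀ ⊥ M_k` for `k ≥ 1`), not
proved here. [cite: Enflo2023, v2 p.5 tex L160–L162] -/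
theorem not_window_of_lat_dichotomy [CompleteSpace H] {T : H →L[ℂ] H} {x₀ : H} (hx₀ : ‖x₀‖ = 1)
    (hLat : ∀ M : Submodule ℂ H, IsClosed (M : Set H) → IsInvariant T M → M ≠ ⊥ → M ≠ ⊤ →
      x₀ ∈ M ∨ x₀ ∈ Mᗮ) :
    ¬ HasInvariantSubspaceInWindow T x₀ := by
  rintro ⟨M, hMc, hb, ht, hMi, hlo, hhi⟩
  rcases hLat M hMc hMi hb ht with hx | hx
  · rw [Metric.infDist_zero_of_mem (SetLike.mem_coe.2 hx)] at hlo
    norm_num at hlo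
  · haveI : CompleteSpace M := hMc.completeSpace_coe
    rw [infDist_eq_norm_sub_starProjection M x₀, (Submodule.starProjection_apply_eq_zero_iff (K := M)).2 hx,
      sub_zero, hx₀] at hhi
    norm_num at hhi

/-- Hence, in that situation, NO norm-convergent Main Construction over `x₀` with the (11)-limit exists ("we will
not get norm convergence to a non-cyclic vector", p.5 L162). [cite: Enflo2023, v2 p.5 tex L160–L162; (11) p.4] -/
theorem not_hasMCLimit_of_lat_dichotomy [CompleteSpace H] {T : H →L[ℂ] H} {x₀ : H} (hx₀ : ‖x₀‖ = 1)
    (hLat : ∀ M : Submodule ℂ H, IsClosed (M : Set H) → IsInvariant T M → M ≠ ⊥ → M ≠ ⊤ →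
      x₀ ∈ M ∨ x₀ ∈ Mᗮ) :
    ¬ HasMCLimit T x₀ :=
  fun h => not_window_of_lat_dichotomy hx₀ hLat h.hasInvariantSubspaceInWindow

end Literature.Analysis.OperatorTheory.Enflo2023

end
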